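import Mathlib
import Summits.AtomisticToContinuum.HydrodynamicLimit.Theorems.ImplosionDichotomyDenseExcursionSonicCavityDefsB
import Summits.AtomisticToContinuum.HydrodynamicLimit.Theorems.ImplosionDichotomyDenseExcursionPackingLargeRealResolvent
import Summits.AtomisticToContinuum.HydrodynamicLimit.Theorems.ImplosionDichotomyDenseExcursionPackingRegularPairCk

/-!
# The large-real-`Λ` resolvent as a corollary of the weighted-`C⁵` cavity resolvent
# (crux `DenseExcursion`, stmt-AtomisticToContinuum-12586, line `sonic-cavity-renewal` v6, stub `stub_largeRealResolventCk`)

Proof file (`--supports stmt-AtomisticToContinuum-12586`) for the registered stub `stub_largeRealResolventCk` of the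
reshaped skeleton (v6) of the line `sonic-cavity-renewal`:

  `∀ r W S, BoxPackage r W S → RealBound r W S → CavityResolventCk 5 r W S → LargeRealResolvent r W S`.

v6 replaced the mis-typed weighted-`C⁰` cavity resolvent `CavityResolvent` (hypothesis of the landed v5 stub
`stub_largeRealResolvent`, file `…PackingLargeRealResolvent`) by `CavityResolventCk 5` (file `…SonicCavityDefsB`): the source
is measured by the weighted `C⁵` seminorm `WCkBound 5 f g N := ∀ y ≤ 1, ∀ j ≤ 5, ‖f⁽ʲ⁾(y)‖ + eʸ ‖g⁽ʲ⁾(y)‖ ≤ N`, everything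
else verbatim.

**Mathematics (unchanged from v5 except for ONE point).** Let `Λ₁ ∈ (6(r−1), 9(r−1))` be the package rate of `BoxPackage`
(with its smooth mode) and `C` the constant of `CavityResolventCk 5` at `Λ₁`. Put `Λ₀ := 101 + |Λ₁| + |r|`. For real `Λ ≥ Λ₀`:

* (i) no smooth radial mode at `(Λ : ℂ)`: `RealBound` gives `Λ = Re Λ ≤ boxSide = 100 < 101 ≤ Λ`;
* (ii) given a real centre-regular source `(f₁, f₂)`, ITS WEIGHTED `C⁵` SEMINORM ON `y ≤ 1` IS FINITE — the new point,
  `wCkBound_of_isRegularPair` below, which is the landed helper `iteratedDeriv_bound_of_isRegularPair`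
  (file `…PackingRegularPairCk`: conjugated form `f = e^{−x} φ(eˣ)`, `g = e^{−x} ψ(eˣ)` along the ray `t e₀`, stability of
  that form under `d/dx` through the Euler-type operator `T u = t u′ − u`, mean value inequality on `[0, e]`) read through
  the definition of `WCkBound`. The four constraints `Re Λ ≥ −1/5`, `‖Λ‖, ‖Λ − Λ₁‖, ‖Λ − r‖ ≥ 1/20` hold since `Λ ≥ 101`,
  `Λ − Λ₁ ≥ 1`, `Λ − r ≥ 1`, so `CavityResolventCk 5` yields a smooth centre-regular complex solution `(ŵ, ŝ)` of
  `(Λ − L)(ŵ, ŝ) = (f₁, f₂)`, whose componentwise REAL PART is again smooth and centre-regular (`isRegularPair_re`) and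
  solves the same equations (`re_solves`: `Λ`, the coefficients of `L = (linW, linS)` and the data are real).

NOT here: `BoxPackage`, `RealBound`, `CavityResolventCk 5` themselves (hypotheses; other stubs of the line).
-/

noncomputable section

open Set Filter Topology
open scoped ContDiff

namespace Summit.AtomisticToContinuum.HydrodynamicLimit.Theorems.PackingAnalyticImplosion

open Summit.AtomisticToContinuum.HydrodynamicLimit.Theorems.R2OneModeTwoConditions
open Summit.AtomisticToContinuum.HydrodynamicLimit.Theorems.SonicCavityRenewal

/-! ## The weighted `C^k` seminorm of a centre-regular pair is finite -/

/-- For every `k`, a smooth centre-regular complex pair `(f, g)` admits a weighted `C^k` bound `WCkBound k f g N` on the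
core + margin `x ≤ 1` — the landed `iteratedDeriv_bound_of_isRegularPair` (file `…PackingRegularPairCk`) read through
the definition of `WCkBound`. [folklore] -/
theorem wCkBound_of_isRegularPair (k : ℕ) {f g : ℝ → ℂ} (h : IsRegularPair f g) : ∃ N : ℝ, WCkBound k f g N :=
  iteratedDeriv_bound_of_isRegularPair k f g h

/-! ## The stub -/

/-- **Stub `stub_largeRealResolventCk` of line `sonic-cavity-renewal` (skeleton v6): THE LARGE-REAL-`Λ` RESOLVENT IS A
COROLLARY OF THE WEIGHTED-`C⁵` CAVITY RESOLVENT.** From the box package (its rate `Λ₁` and smooth mode instantiate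
`CavityResolventCk 5`), the real-part bound (`Re Λ ≤ boxSide = 100` for every smooth radial mode) and the weighted-`C⁵`
cavity resolvent: with `Λ₀ := 101 + |Λ₁| + |r|`, for every real `Λ ≥ Λ₀` (i) there is no smooth radial mode at `Λ`, and
(ii) every smooth centre-regular real source has a smooth centre-regular real solution of `(Λ − L)u = f` — the real part of
the complex solution delivered by `CavityResolventCk 5` (the source's weighted `C⁵` seminorm is finite by
`wCkBound_of_isRegularPair`; the constraints `Re Λ ≥ −1/5`, `‖Λ‖, ‖Λ − Λ₁‖, ‖Λ − r‖ ≥ 1/20` are automatic). [folklore] -/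
theorem stub_largeRealResolventCk :
    ∀ (r : ℝ) (W S : ℝ → ℝ), BoxPackage r W S → RealBound r W S → CavityResolventCk 5 r W S → LargeRealResolvent r W S := by
  intro r W S hbox hre hres
  obtain ⟨Λ₁, h6, h9, hmode, -, -, -, -⟩ := hbox
  obtain ⟨C, -, hsolve⟩ := hres Λ₁ h6 h9 hmode
  refine ⟨101 + |Λ₁| + |r|, fun Λ hΛ => ⟨fun ŵ ŝ hm => ?_, fun f₁ f₂ hf => ?_⟩⟩
  · -- (i) exclusion: `Re Λ ≤ boxSide = 100 < 101 ≤ Λ`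
    have h := hre (Λ : ℂ) ŵ ŝ hm
    rw [Complex.ofReal_re] at h
    have hb : boxSide = 100 := rfl
    linarith [abs_nonneg Λ₁, abs_nonneg r]
  · -- (ii) solvability: real part of the weighted-`C⁵` cavity-resolvent solution
    obtain ⟨N, hN⟩ := wCkBound_of_isRegularPair 5 hf
    have hΛ0 : (101 : ℝ) ≤ Λ := by linarith [abs_nonneg Λ₁, abs_nonneg r]
    have hΛ1 : (1 : ℝ) ≤ Λ - Λ₁ := by linarith [le_abs_self Λ₁, abs_nonneg r]
    have hΛr : (1 : ℝ) ≤ Λ - r := by linarith [le_abs_self r, abs_nonneg Λ₁]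
    obtain ⟨ŵ, ŝ, hreg, heq, -, -⟩ := hsolve (Λ : ℂ) (by rw [Complex.ofReal_re]; linarith)
      (by rw [Complex.norm_of_nonneg (by linarith)]; linarith)
      (by rw [← Complex.ofReal_sub, Complex.norm_of_nonneg (by linarith)]; linarith)
      (by rw [← Complex.ofReal_sub, Complex.norm_of_nonneg (by linarith)]; linarith)
      (fun x => (f₁ x : ℂ)) (fun x => (f₂ x : ℂ)) hf N hN
    exact ⟨fun x => (ŵ x).re, fun x => (ŝ x).re, isRegularPair_re hreg, fun x =>
      re_solves (hreg.1.differentiable (by simp)) (hreg.2.1.differentiable (by simp)) heq x⟩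

end Summit.AtomisticToContinuum.HydrodynamicLimit.Theorems.PackingAnalyticImplosion

end
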